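import Summits.AnomalousDissipation.AnomalousDissipation.Theorems.NeutralTaylorWavesNewtonRealisationStubEllipticDensityTools
import Literature.Analysis.FluidPDE.TorusLinearisedNSH1Balance

/-!
# Stub `stub_ellipticDensity` of the line `Sketch`
# (crux stmt-AnomalousDissipation-16315, `NeutralTaylorWaves.NewtonRealisation`)

ELLIPTIC STEP + DENSITY on the Fourier-lattice state space `W ⊂ ℓ²(ℤ³; ℂ³)` of
`Literature.Analysis.FluidPDE.SteadyLattice` (`x ∈ W` represents `x̌ = 𝓕v`, `x(k) = |k|² v̂(k)`, an
`H²`-type norm; `B(x, y) = Π N(x̌, y̌)`, `D₃ x = 2πi k₃ x̌`). Given the `ℓ²`-level bordered a-priori bound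
`‖ȟ‖² + η² ≤ M²(‖T(h, η)‖² + (ℓ h)²)`, `T(h, η) = (4π²ν)h − cD₃h + B(x₀, h) + B(h, x₀) − ηD₃x₀`, for the
`h ∈ W` with rapidly decaying `ȟ` (a hypothesis here), the `W`-norm bound
`‖h‖ + |η| ≤ 10 (1+M)²(1+C)²ν⁻² (‖T(h, η)‖ + |ℓ h|)` holds for ALL `(h, η) ∈ W × ℝ`:

* elliptic step (`elliptic_step`): `4π²ν‖h‖ ≤ ‖T‖ + |c|‖D₃h‖ + ‖B(x₀,h)‖ + ‖B(h,x₀)‖ + |η|‖D₃x₀‖`, where,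
  with `v` the real synthesis of `ȟ` (`realSynth_spec`), `‖D₃h‖² ≤ ‖∇v‖₂²`, `‖B(x₀,h)‖² ≤ ∫‖u₀·∇v‖² ≤
  3C²‖∇v‖₂²`, `‖B(h,x₀)‖² ≤ ∫‖v·∇u₀‖² ≤ 9C²ν⁻²‖v‖₂²`, `‖D₃x₀‖² = ∫‖∂₃u₀‖² ≤ C²ν⁻²` (the tools file,
  the sup bounds `|u₀| ≤ C`, `|∂u₀| ≤ Cν⁻¹`), and `‖∇v‖₂² ≤ 4π²‖ȟ‖‖h‖`; absorbed by `4XY ≤ (X + Y)²`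
  (`elliptic_arith`, pure real arithmetic);
* density: along the truncations of `exists_truncSeq` both sides of the bound are continuous in `h`.

References: R. Temam, *Navier–Stokes Equations* (1979), Ch. II §1; folklore.
-/

set_option linter.dupNamespace false

noncomputable section

open scoped BigOperators Topology ENNReal NNReal InnerProductSpace ComplexConjugate
open Filter Set Function MeasureTheory UnitAddTorus
open Literature.Analysis Literature.Analysis.FunctionSpaces Literature.Analysis.FunctionSpaces.Torus
open Literature.Analysis.FunctionSpaces.EuclideanSpace
open Literature.Analysis.FluidPDE.ScalarFourier
open Literature.Analysis.FluidPDE.SteadyLattice Literature.Analysis.FluidPDE.SteadyLatticeDrift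

namespace Summit.AnomalousDissipation.AnomalousDissipation.Theorems.NewtonRealisation.EllipticDensity

/-- The flat unit three-torus (local notation). -/
local notation "𝕋³" => UnitAddTorus (Fin 3)
/-- Velocity values (local notation). -/
local notation "E³" => EuclideanSpace ℝ (Fin 3)

/-- Square-summable families `ℤ³ → ℂ³` (local notation). -/
local notation "ℓ2" => lp (fun _ : Fin 3 → ℤ => EuclideanSpace ℂ (Fin 3)) 2
/-- The physical coefficients `x̌(k) = x(k)/|k|²` of a lattice family (local notation, = the frame's `cf`). -/
local notation:max "cf[" x "]" =>
  ((fun mm : Fin 3 → ℤ => (((freqNormSq mm)⁻¹ : ℝ) : ℂ)) • (x : (Fin 3 → ℤ) → EuclideanSpace ℂ (Fin 3)))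
/-- The coordinates of an element of `ℓ²` / of the state space (local notation). -/
local notation:max "cw[" x "]" => (((x : ℓ2)) : (Fin 3 → ℤ) → EuclideanSpace ℂ (Fin 3))
/-- The convective symbol `N(a, b)(k)` as a vector of `ℂ³` (local notation, = the frame's `nl`). -/
local notation:max "nl[" a "," b "]" k:max =>
  (WithLp.toLp 2 (fun pp : Fin 3 => transportSym (fun jj mm => (a : (Fin 3 → ℤ) → EuclideanSpace ℂ (Fin 3)) mm jj)
    (fun mm => (b : (Fin 3 → ℤ) → EuclideanSpace ℂ (Fin 3)) mm pp) k) : EuclideanSpace ℂ (Fin 3))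
/-- `k · v` for `k ∈ ℤ³`, `v ∈ ℂ³` (local notation, = the frame's `kdot`). -/
local notation:max "kdot[" k "," v "]" => (∑ jj : Fin 3, ((k jj : ℤ) : ℂ) * (v : EuclideanSpace ℂ (Fin 3)) jj)

/-! ## Real arithmetic of the elliptic step -/

/-- `1 ≤ 2π²`. [folklore] -/
theorem one_le_two_mul_pi_sq : (1 : ℝ) ≤ 2 * Real.pi ^ 2 := by
  nlinarith [Real.pi_gt_three]

/-- The polynomial loss: `w + 4C²w²M + 4Cw²M + M ≤ 10(1+M)²(1+C)²w²` for `M, C ≥ 0`, `w ≥ 1`. [folklore] -/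
theorem loss_poly_le {M C w : ℝ} (hM : 0 ≤ M) (hC : 0 ≤ C) (hw1 : 1 ≤ w) :
    w + 4 * (C ^ 2 * w ^ 2 * M) + 4 * (C * w ^ 2 * M) + M ≤ 10 * ((1 + M) ^ 2 * (1 + C) ^ 2 * w ^ 2) := by
  have h1 : w ≤ w ^ 2 := le_self_pow₀ hw1 two_ne_zero
  have h2 : M ≤ M * w ^ 2 := le_mul_of_one_le_right hM (one_le_pow₀ hw1)
  nlinarith [mul_nonneg (mul_nonneg hM hC) (sq_nonneg w), mul_nonneg (mul_nonneg hM (sq_nonneg C)) (sq_nonneg w),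
    mul_nonneg (mul_nonneg (sq_nonneg M) hC) (sq_nonneg w), mul_nonneg hC (sq_nonneg w),
    mul_nonneg (mul_nonneg (sq_nonneg M) (sq_nonneg C)) (sq_nonneg w), mul_nonneg (sq_nonneg C) (sq_nonneg w),
    mul_nonneg hM (sq_nonneg w), mul_nonneg (sq_nonneg M) (sq_nonneg w), sq_nonneg w]

/-- Triangle inequality for the rearranged linearised equation `P h = T + cD − B₁ − B₂ + ηD₀` in a real
normed space: `P‖h‖ ≤ ‖T‖ + |c|‖D‖ + ‖B₁‖ + ‖B₂‖ + |η|‖D₀‖` (`P ≥ 0`). [folklore] -/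
theorem mul_norm_le_of_smul_eq {E : Type*} [SeminormedAddCommGroup E] [NormedSpace ℝ E] {P c η : ℝ} (hP : 0 ≤ P)
    {h T D B₁ B₂ D₀ : E} (e : P • h = T + c • D - B₁ - B₂ + η • D₀) :
    P * ‖h‖ ≤ ‖T‖ + |c| * ‖D‖ + ‖B₁‖ + ‖B₂‖ + |η| * ‖D₀‖ := by
  have s0 : ‖P • h‖ = P * ‖h‖ := by rw [norm_smul, Real.norm_of_nonneg hP]
  have s1 : ‖T + c • D - B₁ - B₂ + η • D₀‖ ≤ ‖T + c • D - B₁ - B₂‖ + ‖η • D₀‖ := norm_add_le _ _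
  have s2 : ‖T + c • D - B₁ - B₂‖ ≤ ‖T + c • D - B₁‖ + ‖B₂‖ := norm_sub_le _ _
  have s3 : ‖T + c • D - B₁‖ ≤ ‖T + c • D‖ + ‖B₁‖ := norm_sub_le _ _
  have s4 : ‖T + c • D‖ ≤ ‖T‖ + ‖c • D‖ := norm_add_le _ _
  have s5 : ‖c • D‖ = |c| * ‖D‖ := by rw [norm_smul, Real.norm_eq_abs]
  have s6 : ‖η • D₀‖ = |η| * ‖D₀‖ := by rw [norm_smul, Real.norm_eq_abs]
  have e1 : ‖P • h‖ = ‖T + c • D - B₁ - B₂ + η • D₀‖ := congrArg (‖·‖) e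
  linarith [s0, e1, s1, s2, s3, s4, s5, s6]

/-- From the bordered `ℓ²` bound `a₂ + η² ≤ M²(n² + l²)` to `√a₂ ≤ M(n + |l|)` and `|η| ≤ M(n + |l|)`
(`n, M ≥ 0`). [folklore] -/
theorem sqrt_le_and_abs_le_of_bordered {a₂ η M n l : ℝ} (hM : 0 ≤ M) (hn : 0 ≤ n) (ha₂ : 0 ≤ a₂)
    (hap : a₂ + η ^ 2 ≤ M ^ 2 * (n ^ 2 + l ^ 2)) :
    Real.sqrt a₂ ≤ M * (n + |l|) ∧ |η| ≤ M * (n + |l|) := by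
  have hl : 0 ≤ |l| := abs_nonneg l
  have hMt : 0 ≤ M * (n + |l|) := by positivity
  have hsq : a₂ + η ^ 2 ≤ (M * (n + |l|)) ^ 2 := by
    calc a₂ + η ^ 2 ≤ M ^ 2 * (n ^ 2 + l ^ 2) := hap
      _ ≤ M ^ 2 * (n + |l|) ^ 2 := by
          refine mul_le_mul_of_nonneg_left ?_ (sq_nonneg _)
          rw [← sq_abs l]
          nlinarith
      _ = (M * (n + |l|)) ^ 2 := by ring
  refine ⟨(sq_le_sq₀ (Real.sqrt_nonneg _) hMt).1 ?_, (sq_le_sq₀ (abs_nonneg η) hMt).1 ?_⟩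
  · rw [Real.sq_sqrt ha₂]
    nlinarith [sq_nonneg η]
  · rw [sq_abs]
    nlinarith

/-- **The absorption arithmetic of the elliptic step** (pure real inequalities): with `w = ν⁻¹ ≥ 1`,
`4π²νP ≤ n + γd + b₁ + b₂ + e d₀`, `d², b₁²/(3C²) ≤ 4π² aP`, `b₂ ≤ 3Cwa`, `d₀ ≤ Cw`, `γ ≤ C`,
`a, e ≤ M(n + q)`, one gets `P + e ≤ 10(1+M)²(1+C)²w²(n + q)` (`4XY ≤ (X + Y)²`, `2π² ≥ 1`,
`loss_poly_le`). [folklore] -/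
theorem elliptic_arith {ν w M C a P n q e d b₁ b₂ d₀ γ : ℝ} (hν : 0 < ν) (hνw : ν * w = 1) (hw1 : 1 ≤ w)
    (hM : 0 ≤ M) (hC : 0 ≤ C) (ha : 0 ≤ a) (hPnn : 0 ≤ P) (hn : 0 ≤ n) (hq : 0 ≤ q)
    (hd : 0 ≤ d) (hb₁ : 0 ≤ b₁) (hb₂ : 0 ≤ b₂) (hd₀ : 0 ≤ d₀) (hγ : 0 ≤ γ) (hγC : γ ≤ C)
    (hale : a ≤ M * (n + q)) (hele : e ≤ M * (n + q))
    (hmain : 4 * Real.pi ^ 2 * ν * P ≤ n + γ * d + b₁ + b₂ + e * d₀)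
    (hdd : d ^ 2 ≤ 4 * Real.pi ^ 2 * (a * P)) (hbb₁ : b₁ ^ 2 ≤ 3 * C ^ 2 * (4 * Real.pi ^ 2 * (a * P)))
    (hbb₂ : b₂ ^ 2 ≤ (3 * (C * w)) ^ 2 * a ^ 2) (hdd₀ : d₀ ^ 2 ≤ (C * w) ^ 2) :
    P + e ≤ 10 * (1 + M) ^ 2 * (1 + C) ^ 2 * w ^ 2 * (n + q) := by
  have hw0 : 0 ≤ w := zero_le_one.trans hw1
  have ht : 0 ≤ n + q := add_nonneg hn hq
  have hMt : 0 ≤ M * (n + q) := mul_nonneg hM ht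
  have hX : 0 ≤ Real.pi ^ 2 * ν * P := by positivity
  -- absorption `4XY ≤ (X + Y)²`
  have key1 : γ * d ≤ Real.pi ^ 2 * ν * P + C ^ 2 * w * a := by
    refine (sq_le_sq₀ (by positivity) (by positivity)).1 ?_
    calc (γ * d) ^ 2 = γ ^ 2 * d ^ 2 := mul_pow _ _ _
      _ ≤ C ^ 2 * (4 * Real.pi ^ 2 * (a * P)) :=
          mul_le_mul (pow_le_pow_left₀ hγ hγC 2) hdd (sq_nonneg _) (sq_nonneg _)
      _ = 4 * (Real.pi ^ 2 * ν * P) * (C ^ 2 * w * a) := by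
          linear_combination (-(4 * Real.pi ^ 2 * a * P * C ^ 2)) * hνw
      _ ≤ (Real.pi ^ 2 * ν * P + C ^ 2 * w * a) ^ 2 := four_mul_le_sq_add _ _
  have key2 : b₁ ≤ Real.pi ^ 2 * ν * P + 3 * C ^ 2 * w * a := by
    refine (sq_le_sq₀ hb₁ (by positivity)).1 ?_
    calc b₁ ^ 2 ≤ 3 * C ^ 2 * (4 * Real.pi ^ 2 * (a * P)) := hbb₁
      _ = 4 * (Real.pi ^ 2 * ν * P) * (3 * C ^ 2 * w * a) := by
          linear_combination (-(12 * Real.pi ^ 2 * a * P * C ^ 2)) * hνw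
      _ ≤ (Real.pi ^ 2 * ν * P + 3 * C ^ 2 * w * a) ^ 2 := four_mul_le_sq_add _ _
  have key3 : b₂ ≤ 3 * (C * w) * a :=
    (sq_le_sq₀ hb₂ (by positivity)).1 (by rw [mul_pow]; exact hbb₂)
  have key4 : d₀ ≤ C * w := (sq_le_sq₀ hd₀ (by positivity)).1 hdd₀
  have key5 : e * d₀ ≤ M * (n + q) * (C * w) := mul_le_mul hele key4 hd₀ hMt
  have h6 : (4 * C ^ 2 + 3 * C) * w * a ≤ (4 * C ^ 2 + 3 * C) * w * (M * (n + q)) :=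
    mul_le_mul_of_nonneg_left hale (by positivity)
  have h7 : 2 * Real.pi ^ 2 * ν * P ≤ (n + q) * (1 + (4 * C ^ 2 + 4 * C) * w * M) := by
    linarith [hmain, key1, key2, key3, key5, h6]
  -- from `2π²νP` to `P`
  have hνP : ν * P ≤ (n + q) * (1 + (4 * C ^ 2 + 4 * C) * w * M) := by
    have h0 : 0 ≤ ν * P := mul_nonneg hν.le hPnn
    have h2 : ν * P ≤ 2 * Real.pi ^ 2 * (ν * P) := le_mul_of_one_le_left h0 one_le_two_mul_pi_sq
    have h3 : 2 * Real.pi ^ 2 * (ν * P) = 2 * Real.pi ^ 2 * ν * P := by ring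
    exact (h3 ▸ h2).trans h7
  have hPw : P ≤ (n + q) * (w + 4 * (C ^ 2 * w ^ 2 * M) + 4 * (C * w ^ 2 * M)) := by
    have e1 : P = w * (ν * P) := by rw [← mul_assoc, mul_comm w, hνw, one_mul]
    have e2 : w * ((n + q) * (1 + (4 * C ^ 2 + 4 * C) * w * M)) =
        (n + q) * (w + 4 * (C ^ 2 * w ^ 2 * M) + 4 * (C * w ^ 2 * M)) := by ring
    rw [e1, ← e2]
    exact mul_le_mul_of_nonneg_left hνP hw0
  -- the polynomial loss
  linarith [mul_le_mul_of_nonneg_left (loss_poly_le hM hC hw1) ht, hPw, hele]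

/-! ## The elliptic step -/

section StateSpace

variable {W : Submodule ℝ ℓ2}
  (hW : ∀ x : ℓ2, x ∈ W ↔ cw[x] 0 = 0 ∧ (∀ kk : Fin 3 → ℤ, kdot[kk, cw[x] kk] = 0) ∧ IsConjSymm cw[x])
include hW

/-- **ELLIPTIC STEP** (for `h` with rapidly decaying `ȟ`): from the `ℓ²`-level bordered bound
`‖ȟ‖² + η² ≤ M²(‖T‖² + (ℓ h)²)`, `T = (4π²ν)h − cD₃h + B(x₀,h) + B(h,x₀) − ηD₃x₀`, to the `W`-norm bound
`‖h‖ + |η| ≤ 10 (1+M)²(1+C)²ν⁻² (‖T‖ + |ℓ h|)`: `4π²ν‖h‖ ≤ ‖T‖ + |c|‖D₃h‖ + ‖B(x₀,h)‖ + ‖B(h,x₀)‖ + |η|‖D₃x₀‖`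
with `‖D₃h‖², ‖B(x₀,h)‖²/(3C²) ≤ ‖∇v‖₂² ≤ 4π²‖ȟ‖‖h‖`, `‖B(h,x₀)‖ ≤ 3Cν⁻¹‖v‖₂`, `‖D₃x₀‖ ≤ Cν⁻¹`
(`v` the real synthesis of `ȟ`, sup bounds on `u₀`, `∇u₀`), then `elliptic_arith`. [folklore] -/
theorem elliptic_step {B : W → W → W}
    (hB : ∀ x y : W, cw[B x y] = fun k => FluidPDE.Torus.lerayCoeff k (nl[cf[cw[x]], cf[cw[y]]] k))
    {D₃ : W →L[ℝ] W}
    (hD₃ : ∀ x : W, cw[D₃ x] = fun k => (2 * Real.pi * Complex.I * ((k (2 : Fin 3) : ℤ) : ℂ)) • cf[cw[x]] k)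
    {ν c M C : ℝ} {u₀ : 𝕋³ → E³} {x₀ : W} (ℓ : W →L[ℝ] ℝ)
    (hν : 0 < ν) (hν1 : ν ≤ 1) (hM : 0 ≤ M) (hC : 0 ≤ C) (hu₀ : IsSmooth u₀) (hc : |c| ≤ C)
    (hsup : ∀ x, ‖u₀ x‖ ≤ C) (hgrad : ∀ (i : Fin 3) x, ‖Torus.partialDeriv i u₀ x‖ ≤ C * ν⁻¹)
    (hx₀ : cf[cw[x₀]] = mFourierCoeff (complexify ∘ u₀)) (h : W) (η : ℝ) (hr : RapidDecay cf[cw[h]])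
    (hap : (∑' k : Fin 3 → ℤ, ‖cf[cw[h]] k‖ ^ 2) + η ^ 2 ≤
      M ^ 2 * (‖(4 * Real.pi ^ 2 * ν) • h - c • D₃ h + B x₀ h + B h x₀ - η • D₃ x₀‖ ^ 2 + (ℓ h) ^ 2)) :
    ‖h‖ + |η| ≤ 10 * (1 + M) ^ 2 * (1 + C) ^ 2 * ν⁻¹ ^ 2 *
      (‖(4 * Real.pi ^ 2 * ν) • h - c • D₃ h + B x₀ h + B h x₀ - η • D₃ x₀‖ + |ℓ h|) := by
  -- the real synthesis `v` of `ȟ`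
  obtain ⟨hv, -, hvc⟩ := realSynth_spec hr (isConjSymm_cf (W_conj hW h))
  have ha2 : 0 ≤ ∑' k : Fin 3 → ℤ, ‖cf[cw[h]] k‖ ^ 2 := tsum_nonneg fun k => sq_nonneg _
  have hνw : ν * ν⁻¹ = 1 := mul_inv_cancel₀ hν.ne'
  have hw1 : 1 ≤ ν⁻¹ := (one_le_inv₀ hν).2 hν1
  -- `√a₂ ≤ M t`, `|η| ≤ M t`
  obtain ⟨hale, hele⟩ := sqrt_le_and_abs_le_of_bordered hM (norm_nonneg _) ha2 hap
  -- the four operator norms, through the physical fields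
  have hG : gradNormSq (fun y => EuclideanSpace.realPart (fourierSynth cf[cw[h]] y)) ≤
      4 * Real.pi ^ 2 * (Real.sqrt (∑' k : Fin 3 → ℤ, ‖cf[cw[h]] k‖ ^ 2) * ‖h‖) := by
    have := gradNormSq_le_of_coeff_eq_cf hv (h : ℓ2) hvc
    rwa [norm_coeW] at this
  have hL2 := integral_norm_sq_eq_tsum (hv.memLp 2)
  rw [hvc] at hL2
  have hBl : ‖B x₀ h‖ ^ 2 ≤ 3 * C ^ 2 * (4 * Real.pi ^ 2 * (Real.sqrt (∑' k : Fin 3 → ℤ, ‖cf[cw[h]] k‖ ^ 2) * ‖h‖)) := by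
    refine (norm_B_sq_le_integral hB x₀ h hu₀ hv hx₀ hvc.symm).trans ?_
    refine (FluidPDE.Torus.integral_norm_sq_convect_le_of_norm_le hv hsup).trans ?_
    have h3 : ((Fintype.card (Fin 3) : ℕ) : ℝ) = 3 := by norm_num
    rw [h3]
    exact mul_le_mul_of_nonneg_left hG (by positivity)
  have hBr : ‖B h x₀‖ ^ 2 ≤ (3 * (C * ν⁻¹)) ^ 2 * Real.sqrt (∑' k : Fin 3 → ℤ, ‖cf[cw[h]] k‖ ^ 2) ^ 2 := by
    refine (norm_B_sq_le_integral hB h x₀ hv hu₀ hvc.symm hx₀).trans ?_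
    have h2 := FluidPDE.Torus.integral_norm_sq_convect_le_of_partialDeriv_le hu₀ hv
      (C := fun _ => C * ν⁻¹) hgrad
    rw [hL2] at h2
    refine h2.trans (le_of_eq ?_)
    rw [Real.sq_sqrt ha2]
    simp only [Finset.sum_const, Finset.card_univ, Fintype.card_fin, nsmul_eq_mul, Nat.cast_ofNat]
  have hD3h : ‖D₃ h‖ ^ 2 ≤ 4 * Real.pi ^ 2 * (Real.sqrt (∑' k : Fin 3 → ℤ, ‖cf[cw[h]] k‖ ^ 2) * ‖h‖) := by
    rw [norm_D₃_sq_eq_integral hD₃ h hv hvc.symm]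
    exact (integral_partialDeriv_sq_le_gradNormSq hv 2).trans hG
  have hD3x : ‖D₃ x₀‖ ^ 2 ≤ (C * ν⁻¹) ^ 2 := by
    rw [norm_D₃_sq_eq_integral hD₃ x₀ hu₀ hx₀]
    exact integral_norm_sq_le_sq_of_norm_le (hu₀.partialDeriv 2) (hgrad 2)
  -- the norm inequality (triangle inequality)
  have hP : 4 * Real.pi ^ 2 * ν * ‖h‖ ≤ ‖(4 * Real.pi ^ 2 * ν) • h - c • D₃ h + B x₀ h + B h x₀ - η • D₃ x₀‖ +
      |c| * ‖D₃ h‖ + ‖B x₀ h‖ + ‖B h x₀‖ + |η| * ‖D₃ x₀‖ := by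
    refine mul_norm_le_of_smul_eq (by positivity) ?_
    abel
  exact elliptic_arith hν hνw hw1 hM hC (Real.sqrt_nonneg _) (norm_nonneg h) (norm_nonneg _) (abs_nonneg _)
    (norm_nonneg _) (norm_nonneg _) (norm_nonneg _) (norm_nonneg _) (abs_nonneg c) hc hale hele
    hP hD3h hBl hBr hD3x

end StateSpace

/-- Continuity in `z` of the right-hand side `K(‖Pz − cDz + B₁z + B₂z − ηe₀‖ + |ℓ z|)` of the target bound, in
a real normed space (`B₁`, `B₂` continuous, `D`, `ℓ` continuous linear). [folklore] -/
theorem continuous_bordered_rhs {E : Type*} [NormedAddCommGroup E] [NormedSpace ℝ E]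
    (K P c η : ℝ) (D : E →L[ℝ] E) {B₁ B₂ : E → E} (hB₁ : Continuous B₁) (hB₂ : Continuous B₂) (e₀ : E)
    (ℓ : E →L[ℝ] ℝ) :
    Continuous fun z : E => K * (‖P • z - c • D z + B₁ z + B₂ z - η • e₀‖ + |ℓ z|) := by
  refine continuous_const.mul (Continuous.add (Continuous.norm ?_) (continuous_abs.comp ℓ.continuous))
  exact ((((continuous_const.smul continuous_id).sub (continuous_const.smul D.continuous)).add hB₁).add
    hB₂).sub continuous_const

/-! ## The stub -/

/-- **stub L3 — ELLIPTIC STEP + DENSITY** (the registered stub `stub_ellipticDensity` of the line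
`Sketch`): from the lattice `ℓ²` a-priori bound (a hypothesis, valid for `h ∈ W` with rapidly decaying
`ȟ`) to the `W`-norm inverse bound with polynomial loss `A(1+M)^k(1+C)^kν^{-k}`, `k = 2`, `A = 10`, for
ALL `(h, η) ∈ W × ℝ`: the elliptic step `elliptic_step` on the dense set of truncations
(`exists_truncSeq`), then the limit along the truncations — both sides are continuous in `h`
(`B` bounded bilinear, `D₃`, `ℓ` continuous linear). [folklore] -/
theorem stub_ellipticDensity :
    ∃ (k : ℕ) (A : ℝ), 0 < A ∧ ∀ {W : Submodule ℝ ℓ2}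
      (hW : ∀ x : ℓ2, x ∈ W ↔ cw[x] 0 = 0 ∧ (∀ kk : Fin 3 → ℤ, kdot[kk, cw[x] kk] = 0) ∧ IsConjSymm cw[x])
      {B : W → W → W} (hB : ∀ x y : W, cw[B x y] = fun k => FluidPDE.Torus.lerayCoeff k (nl[cf[cw[x]], cf[cw[y]]] k))
      (hBb : IsBoundedBilinearMap ℝ (fun p : W × W => B p.1 p.2))
      {D₃ : W →L[ℝ] W}
      (hD₃ : ∀ x : W, cw[D₃ x] = fun k => (2 * Real.pi * Complex.I * ((k (2 : Fin 3) : ℤ) : ℂ)) • cf[cw[x]] k)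
      (ν c M C : ℝ) (u₀ : 𝕋³ → E³) (x₀ : W) (ℓ : W →L[ℝ] ℝ),
      0 < ν → ν ≤ 1 → 0 ≤ M → 0 ≤ C → IsSmooth u₀ → IsDivFree u₀ → HasZeroMean u₀ → |c| ≤ C →
      (∀ x, ‖u₀ x‖ ≤ C) → (∀ (i : Fin 3) x, ‖Torus.partialDeriv i u₀ x‖ ≤ C * ν⁻¹) →
      cf[cw[x₀]] = mFourierCoeff (complexify ∘ u₀) →
      (∀ (h : W) (η : ℝ), RapidDecay cf[cw[h]] →
        (∑' k : Fin 3 → ℤ, ‖cf[cw[h]] k‖ ^ 2) + η ^ 2 ≤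
          M ^ 2 * (‖(4 * Real.pi ^ 2 * ν) • h - c • D₃ h + B x₀ h + B h x₀ - η • D₃ x₀‖ ^ 2 + (ℓ h) ^ 2)) →
      ∀ (h : W) (η : ℝ), ‖h‖ + |η| ≤ A * (1 + M) ^ k * (1 + C) ^ k * ν⁻¹ ^ k *
        (‖(4 * Real.pi ^ 2 * ν) • h - c • D₃ h + B x₀ h + B h x₀ - η • D₃ x₀‖ + |ℓ h|) := by
  refine ⟨2, 10, by norm_num, ?_⟩
  intro W hW B hB hBb D₃ hD₃ ν c M C u₀ x₀ ℓ hν hν1 hM hC hu₀ _hdiv _hzm hc hsup hgrad hx₀ hap h η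
  obtain ⟨y, hyr, hyt⟩ := exists_truncSeq hW h
  -- the bound on the dense set
  have hineq : ∀ N, ‖y N‖ + |η| ≤ 10 * (1 + M) ^ 2 * (1 + C) ^ 2 * ν⁻¹ ^ 2 *
      (‖(4 * Real.pi ^ 2 * ν) • y N - c • D₃ (y N) + B x₀ (y N) + B (y N) x₀ - η • D₃ x₀‖ + |ℓ (y N)|) :=
    fun N => elliptic_step hW hB hD₃ ℓ hν hν1 hM hC hu₀ hc hsup hgrad hx₀ (y N) η (hyr N) (hap (y N) η (hyr N))
  -- both sides are continuous in `h`
  have hlhs : Tendsto (fun N => ‖y N‖ + |η|) atTop (𝓝 (‖h‖ + |η|)) :=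
    ((continuous_norm.tendsto h).comp hyt).add tendsto_const_nhds
  have hB1 : Continuous fun z : W => B x₀ z := hBb.continuous.comp (continuous_const.prodMk continuous_id)
  have hB2 : Continuous fun z : W => B z x₀ := hBb.continuous.comp (continuous_id.prodMk continuous_const)
  have hcont := continuous_bordered_rhs (10 * (1 + M) ^ 2 * (1 + C) ^ 2 * ν⁻¹ ^ 2) (4 * Real.pi ^ 2 * ν) c η D₃
    hB1 hB2 (D₃ x₀) ℓ
  have hrhs := (hcont.tendsto h).comp hyt
  exact le_of_tendsto_of_tendsto' hlhs hrhs hineq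

end Summit.AnomalousDissipation.AnomalousDissipation.Theorems.NewtonRealisation.EllipticDensity

end
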